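import Summits.Ventures.CertifiedManyBodySolver.Downfold.EmeryBoxesLa214KungThermalCapRetiltMarkovBoxp1
import Summits.Ventures.CertifiedManyBodySolver.Downfold.EmeryBoxesLa214KungThermalFloorAtlasWord
import Summits.Ventures.CertifiedManyBodySolver.Downfold.EmeryThermalAtomicFloor
import HarnessLib

/-!
# HIGH-TEMPERATURE-CLOSING `T > 0` WINDOW on La2CuO4 (M13) U-SLICE «Kung canonical» (8.5, 4.1) — `emeryBoxLa214Kung` (router/EMERY-FLOOR-ORDERS row 5): the ATOMIC-LIMIT floor (full entropy) ∨ the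
# family floor, against the re-tilted cap — both sides meet at `6 log 2` as β → 0

Venture CertifiedManyBodySolver, cell `pub/hubbard-downfold` (S1 = ROUTER) × crew hubbard-fast S2 (ii) × (iv) «T > 0 × multi-band» (D-0096 (ii)); seat hubbard-downfold-mod-4
(S1/S2 Emery seam, g17). Namespace `Summit.Ventures.CertifiedManyBodySolver.Downfold`. DOOR: `EmeryThermalAtomicFloor` (`holdsOn_emeryCellPressureAtomicFloor`: Peierls on the
whole occupation basis of the `Cu₄O₈` block, site-wise factorisation; the one-site function is the tree's `atomicPartitionFnReal β U μ`). INPUTS BY NAME: the family floor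
`emeryBoxLa214Kung_pressureFloorFam_m89o10` (`EmeryBoxesLa214KungThermalFloorAtlasWord`; C = (-142.221080, -143.922665)), the cap `emeryBoxLa214Kung_pressureCap_m89o10_retilt` (`EmeryBoxesLa214KungThermalCapRetiltMarkovBoxp1`; `6 log 2 + 42.0853·β`; flat word 46.4853).
ATOMIC DATA: Cu at `μ_d = −(εp + Δ_hi) = 769/100`, `U_d,hi = 17/2`; O at `μ_p = −εp = 89/10`, `U_p,hi = 41/10` ⇒ classical slope 35.0900·β (family slope 35.9807; cap 42.0853).
RESULT: **`emeryBoxLa214Kung_pressureWindowHighT_m89o10`**: `max(atomic, family) ≤ P_cell ≤ 6 log 2 + 42.0853·β` on the whole box, every β ≥ 0; width → 0 as β → 0 (both sides `6 log 2`,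
`emeryBoxLa214Kung_pressure_beta_zero_m89o10`); crossover β* ≈ 0.995 (T* ≈ 11664 K) below which the atomic floor is the better floor [float].

Everything PROVED (0 sorry); no definition. HONEST FRAMING: CERTIFIED inequalities on a SCREENING/EXTRAPOLATED-grade object; the atomic floor ignores hopping (its slope sits
0.8907 below the family floor's), so at physical temperatures (β ≈ 20–40 eV⁻¹) the family floor still decides and thermal scales are NOT resolved there; what is new
is the correct INFINITE-TEMPERATURE closure of the window and a certified high-T regime (β ≲ β*) with width `≈ 6.9953·β`; grand-canonical at the stated level; no phase word;
no router number moves. WHAT-THIS-IS-NOT: a new certificate (pure algebra on landed objects; zero kit).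
-/

noncomputable section

namespace Summit.Ventures.CertifiedManyBodySolver.Downfold

open NonemptyInterval Matrix Finset Literature.Probability.LatticeModels
open Literature.MathematicalPhysics.QuantumLattice Literature.Computation.Certificates
open Summit.Ventures.CertifiedManyBodySolver.Certificates OccupationCode ClusterLowerBound
open scoped BigOperators ComplexOrder

/-! ## §1 The atomic-limit floor on the box at εp = -89/10 -/

/-- **ATOMIC-LIMIT `T > 0` FLOOR** on the whole `emeryBoxLa214Kung`, cuprate signs, level εp = -89/10 (chemical potential 89/10 eV), EVERY β ≥ 0:
`log z₀(β; U_d = 17/2, μ_d = 769/100) + 2·log z₀(β; U_p = 41/10, μ_p = 89/10) ≤ P_cell` with `z₀(β; U, μ) = 1 + 2e^{βμ} + e^{−β(U−2μ)}` (`atomicPartitionFnReal`; Cu at the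
box's upper level `εp + Δ_hi = -769/100` and `U_d,hi`, O at `εp` and `U_p,hi`). Value `6 log 2` at β = 0; slope `35.0900·β` as β → ∞ (classical minimum, no hopping).
[cite: Ruelle1969, §2.5–2.6] [cite: Ueltschi1999, §3] -/
theorem emeryBoxLa214Kung_pressureAtomicFloor_m89o10 {β : ℝ} (hβ : 0 ≤ β) :
    HoldsOn (fun p : EmeryCoord → ℝ => Real.log (atomicPartitionFnReal β (17/2 : ℝ) (769/100 : ℝ)) + 2 * Real.log (atomicPartitionFnReal β (41/10 : ℝ) (89/10 : ℝ)) ≤ emeryCellPressure β (emeryLine cuprateSigns (emeryLineCoords (((-89/10 : ℚ)) : ℝ) p))) emeryBoxLa214Kung := by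
  intro p hp
  have h := holdsOn_emeryCellPressureAtomicFloor (E := emeryBoxLa214Kung) (eA := la214Emery_tpd) (eB := la214Emery_tpp) (eD := la214KungEmery_Delta) (eUd := la214KungEmery_Udd) (eUp := la214KungEmery_Upp) (-89/10) (by simp [emeryBoxLa214Kung, emeryBoxLa214KungSrc, Function.update]) (by simp [emeryBoxLa214Kung, emeryBoxLa214KungSrc, Function.update]) (Function.update_self _ _ _) (by simp [emeryBoxLa214Kung, emeryBoxLa214KungSrc, Function.update]) (by simp [emeryBoxLa214Kung, emeryBoxLa214KungSrc, Function.update]) cuprateSigns hβ p hp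
  simp only [la214KungEmery_Delta, la214KungEmery_Udd, la214KungEmery_Upp, Entry.encl_ofEnds_snd] at h
  push_cast at h
  norm_num at h ⊢
  exact h

/-! ## §2 The best floor and the HIGH-TEMPERATURE-CLOSING window -/

/-- **BEST `T > 0` FLOOR = max(atomic, family)** on the whole box at εp = -89/10, every β ≥ 0: the atomic floor (full entropy, slope 35.0900) wins for
β < β* ≈ 0.995 (T > 11664 K), the family floor `emeryBoxLa214Kung_pressureFloorFam_m89o10` (slope 35.9807, entropy ¼·log 2) for β > β*. [cite: Ruelle1969, §2.5–2.6] [cite: Israel1979, Lemma II.3.1] -/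
theorem emeryBoxLa214Kung_pressureFloorBest_m89o10 {β : ℝ} (hβ : 0 ≤ β) :
    HoldsOn (fun p : EmeryCoord → ℝ => max (Real.log (atomicPartitionFnReal β (17/2 : ℝ) (769/100 : ℝ)) + 2 * Real.log (atomicPartitionFnReal β (41/10 : ℝ) (89/10 : ℝ))) (Real.log (Real.exp (-(β * (-3555527/25000 : ℝ))) + Real.exp (-(β * (-28784533/200000 : ℝ)))) / 4) ≤ emeryCellPressure β (emeryLine cuprateSigns (emeryLineCoords (((-89/10 : ℚ)) : ℝ) p))) emeryBoxLa214Kung :=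
  fun p hp => max_le (emeryBoxLa214Kung_pressureAtomicFloor_m89o10 hβ p hp) (emeryBoxLa214Kung_pressureFloorFam_m89o10 hβ p hp)

/-- **THE HIGH-TEMPERATURE-CLOSING TWO-SIDED `T > 0` WINDOW** (hypothesis-free on both sides) on the whole `emeryBoxLa214Kung`, level εp = -89/10, EVERY β ≥ 0:
`max(atomic, family) ≤ P_cell ≤ 6 log 2 + β·1346729/32000` (cap = `emeryBoxLa214Kung_pressureCap_m89o10_retilt`, hubbard-box-p1 re-tilted). BOTH SIDES EQUAL `6 log 2` AT β = 0; the width is `O(β)` for small β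
(slope gap 6.9953 against the atomic floor, 6.1046 against the family floor). Table [float; `T = 11604.5/β` K]:
| β (1/eV) | T (K) | atomic floor | family floor | best floor | cap | width |
|---|---|---|---|---|---|---|
| 0.01 | 1160450 | 4.3750 | 0.5310 | 4.3750 | 4.5797 | 0.2048 |
| 0.1 | 116045 | 6.5545 | 3.7510 | 6.5545 | 8.3674 | 1.8130 |
| 0.5 | 23209 | 18.8692 | 18.0792 | 18.8692 | 25.2015 | 6.3323 |
| 1 | 11604 | 36.0168 | 36.0226 | 36.0226 | 46.2442 | 10.2216 |
| 2 | 5802 | 70.9678 | 71.9695 | 71.9695 | 88.3294 | 16.3599 |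
| 5 | 2321 | 176.1518 | 179.9034 | 179.9034 | 214.5853 | 34.6819 |
| 10 | 1160 | 351.5933 | 359.8067 | 359.8067 | 425.0117 | 65.2050 |
| 20 | 580 | 702.4931 | 719.6133 | 719.6133 | 845.8645 | 126.2512 |
| 40 | 290 | 1404.2931 | 1439.2267 | 1439.2267 | 1687.5701 | 248.3435 |
[cite: Israel1979, Thm. I.2.4] [cite: Ruelle1969, §2.5–2.6] [cite: Ueltschi1999, §3] -/
theorem emeryBoxLa214Kung_pressureWindowHighT_m89o10 {β : ℝ} (hβ : 0 ≤ β) :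
    HoldsOn (fun p : EmeryCoord → ℝ =>
      max (Real.log (atomicPartitionFnReal β (17/2 : ℝ) (769/100 : ℝ)) + 2 * Real.log (atomicPartitionFnReal β (41/10 : ℝ) (89/10 : ℝ))) (Real.log (Real.exp (-(β * (-3555527/25000 : ℝ))) + Real.exp (-(β * (-28784533/200000 : ℝ)))) / 4) ≤ emeryCellPressure β (emeryLine cuprateSigns (emeryLineCoords (((-89/10 : ℚ)) : ℝ) p)) ∧
      emeryCellPressure β (emeryLine cuprateSigns (emeryLineCoords (((-89/10 : ℚ)) : ℝ) p)) ≤ 6 * Real.log 2 + β * (1346729/32000 : ℝ)) emeryBoxLa214Kung :=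
  fun p hp => ⟨emeryBoxLa214Kung_pressureFloorBest_m89o10 hβ p hp, by simpa using emeryBoxLa214Kung_pressureCap_m89o10_retilt hβ p hp⟩

/-- **At β = 0 the window is a point**: `P_cell(0, ·) = 6 log 2` on the whole box (floor and cap coincide). [cite: Ueltschi1999, §3] -/
theorem emeryBoxLa214Kung_pressure_beta_zero_m89o10 :
    HoldsOn (fun p : EmeryCoord → ℝ => emeryCellPressure 0 (emeryLine cuprateSigns (emeryLineCoords (((-89/10 : ℚ)) : ℝ) p)) = 6 * Real.log 2) emeryBoxLa214Kung := by
  intro p hp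
  have h := emeryBoxLa214Kung_pressureWindowHighT_m89o10 le_rfl p hp
  rw [atomicPartitionFnReal_beta_zero, atomicPartitionFnReal_beta_zero, show (4 : ℝ) = 2 ^ 2 by norm_num, Real.log_pow] at h
  simp only [Nat.cast_ofNat, zero_mul, add_zero] at h
  have h1 := (le_max_left _ _).trans h.1
  linarith [h.2]

end Summit.Ventures.CertifiedManyBodySolver.Downfold

end
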